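import Literature.MathematicalPhysics.QuantumLattice.CloverPseudoscalar
import HarnessLib

/-!
# Time-reflection parity of the clover densities and the pointwise bound `|P| ≤ S`

Topic `Literature/MathematicalPhysics/QuantumLattice`, theorem-only companion of
`CloverPseudoscalar.lean` (definition request `defn-cloverPseudoscalar`; serves the items
`CloverParityRP` and `CloverSelfDualSplit` of route `DualityDefect`, `QuantumFields/YangMills`).

## Parity (Osterwalder–Seiler time reflections)

A time reflection of the site lattice `Fin d → R` is encoded by its action on sites,
`θ (x + e₀) = θ x − e₀` and `θ (x + eᵢ) = θ x + eᵢ` (`i ≠ 0`) — satisfied by the site reflection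
`t ↦ −t` (`QuantumFieldTheory.siteReflect` on `ℤ⁴`, `Site.negReflect` on tori) and by the link
reflection `t ↦ 1 − t` (`Site.timeReflect`) alike — and the reflected configuration `V = ΘU` by
`V (x, i) = U (θ x, i)` (`i ≠ 0`), `V (x, 0) = U (θ (x + e₀), 0)⁻¹` (the temporal link is traversed
backwards; this is the defining formula of the tree's `cfgReflect`, `GaugeConfig.negReflect`,
`GaugeConfig.timeReflect`). For a unitary-valued `ρ`:

* `cloverLeafSum_reflect_of_ne` / `flowedClover_zero_reflect_of_ne`: spatial clovers are carried
  along, `C_{ij}(ΘU, x) = C_{ij}(U, θx)`;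
* `cloverLeafSum_reflect_zero` / `flowedClover_zero_reflect_zero`: a temporal clover is read
  backwards, `Q_{0i}(ΘU, x) = Q_{0i}(U, θx)ᴴ`, so `C_{0i}(ΘU, x) = −C_{0i}(U, θx)` (`π_𝔤(Wᴴ) = −π_𝔤 W`);
* `cloverPseudoscalar_reflect`: **`P` is odd**, `P_x(ΘU) = −P_{θx}(U)` (each term of `P` has
  exactly one temporal clover); `flowedCloverEnergy_zero_reflect`: **`S` is even**.

This is the lattice counterpart of "`q` is a pseudoscalar", the input making `−⟨q(0)q(x)⟩ ≥ 0`
a consequence of reflection positivity (Seiler–Stamatescu; Aguado–Seiler §1). [AguadoSeiler2005]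

Instantiation (checked, not imported here to keep the QCD Grassmann files out of this cone): for
the tree's site reflection `Θ = QuantumFieldTheory.cfgReflect`, `θ = QuantumFieldTheory.siteReflect`
on `LGConfig 4 G` the hypotheses are `siteReflect_add_single_zero`,
`fun y i hi => siteReflect_add_single_of_ne y hi`,
`fun y => by simp [cfgReflect, reflectEdge, siteReflect_add_single_zero]` and
`fun y i hi => by simp [cfgReflect, reflectEdge, hi]`, giving
`cloverPseudoscalar ρ x (cfgReflect U) = -cloverPseudoscalar ρ (siteReflect x) U` and
`flowedCloverEnergy ρ 0 x (cfgReflect U) = flowedCloverEnergy ρ 0 (siteReflect x) U`; the torus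
reflections `GaugeConfig.negReflect` / `GaugeConfig.timeReflect` (`R = ZMod L`) are served the
same way.

## The bound

* `abs_re_trace_mul_le`: `|Re tr(AB)| ≤ (‖A‖² + ‖B‖²)/2` (Cauchy–Schwarz for `Re tr(X†Y)`);
* `abs_cloverPseudoscalar_le_flowedCloverEnergy`: **`|P_x(U)| ≤ S_x(U)`** for every group,
  representation, configuration and site — Muzinich–Nair's `tr F² ≥ |tr F F̃|`, i.e.
  `S ± P ≥ 0`. [MuzinichNair1986]

Everything here is proved.
-/

noncomputable section

open scoped Matrix.Norms.Frobenius
open Matrix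

namespace Literature.MathematicalPhysics.QuantumLattice

attribute [local instance] frobeniusInnerProductSpace

/-! ### Parity under time reflections -/

section Reflection

variable {d : ℕ} [NeZero d] {R : Type*} [AddCommGroup R] [One R] {N : ℕ} {G : Type*} [Group G]
  (ρ : G →* Matrix (Fin N) (Fin N) ℂ)

omit [NeZero d] in
/-- A site map additive along `eᵢ` is additive along `−eᵢ`. [folklore] -/
theorem reflect_sub_single_of_add {θ : (Fin d → R) → (Fin d → R)} {i : Fin d}
    (hθ : ∀ x, θ (x + Pi.single i 1) = θ x + Pi.single i 1) (x : Fin d → R) :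
    θ (x - Pi.single i 1) = θ x - Pi.single i 1 := by
  have h := hθ (x - Pi.single i 1)
  rw [sub_add_cancel] at h
  rw [h, add_sub_cancel_right]

omit [NeZero d] in
/-- A site map reversing `e₀` forwards reverses it backwards. [folklore] -/
theorem reflect_sub_single_of_sub {θ : (Fin d → R) → (Fin d → R)} {i : Fin d}
    (hθ : ∀ x, θ (x + Pi.single i 1) = θ x - Pi.single i 1) (x : Fin d → R) :
    θ (x - Pi.single i 1) = θ x + Pi.single i 1 := by
  have h := hθ (x - Pi.single i 1)
  rw [sub_add_cancel] at h
  rw [h, sub_add_cancel]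

/-- **Spatial clovers are carried along by a time reflection**: if `θ` translates spatial shifts
and `V` agrees with `U ∘ θ` on spatial links, then `Q_{μν}(V, x) = Q_{μν}(U, θx)` for spatial
`μ, ν`. [folklore] -/
theorem cloverLeafSum_reflect_of_ne (θ : (Fin d → R) → (Fin d → R))
    (hθ : ∀ x (i : Fin d), i ≠ 0 → θ (x + Pi.single i 1) = θ x + Pi.single i 1)
    (U V : (Fin d → R) × Fin d → G) (hV : ∀ x (i : Fin d), i ≠ 0 → V (x, i) = U (θ x, i))
    (x : Fin d → R) {μ ν : Fin d} (hμ : μ ≠ 0) (hν : ν ≠ 0) :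
    cloverLeafSum (fun e => ρ (V e)) x μ ν = cloverLeafSum (fun e => ρ (U e)) (θ x) μ ν := by
  have hμ' := reflect_sub_single_of_add (fun y => hθ y μ hμ)
  have hν' := reflect_sub_single_of_add (fun y => hθ y ν hν)
  simp only [cloverLeafSum, hV _ _ hμ, hV _ _ hν, hθ _ _ hμ, hθ _ _ hν, hμ', hν']

/-- **A temporal clover is read backwards by a time reflection**: with `θ (x + e₀) = θ x − e₀` and
the temporal links of `V` the reversed temporal links of `U`, `Q_{0i}(V, x) = Q_{0i}(U, θx)ᴴ`
(unitary `ρ`). [folklore] -/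
theorem cloverLeafSum_reflect_zero (hρ : ∀ g, ρ g ∈ Matrix.unitaryGroup (Fin N) ℂ)
    (θ : (Fin d → R) → (Fin d → R)) (hθ0 : ∀ x, θ (x + Pi.single 0 1) = θ x - Pi.single 0 1)
    (hθ : ∀ x (i : Fin d), i ≠ 0 → θ (x + Pi.single i 1) = θ x + Pi.single i 1)
    (U V : (Fin d → R) × Fin d → G) (hV0 : ∀ x, V (x, 0) = (U (θ (x + Pi.single 0 1), 0))⁻¹)
    (hV : ∀ x (i : Fin d), i ≠ 0 → V (x, i) = U (θ x, i)) (x : Fin d → R) {i : Fin d} (hi : i ≠ 0) :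
    cloverLeafSum (fun e => ρ (V e)) x 0 i = (cloverLeafSum (fun e => ρ (U e)) (θ x) 0 i)ᴴ := by
  have hθ0' := reflect_sub_single_of_sub hθ0
  have hi' := reflect_sub_single_of_add (fun y => hθ y i hi)
  set e0 : Fin d → R := Pi.single 0 1 with he0
  set ei : Fin d → R := Pi.single i 1 with hei
  have hθi : ∀ y, θ (y + ei) = θ y + ei := fun y => hθ y i hi
  have m1 : θ x + ei - e0 = θ x - e0 + ei := by abel
  have m2 : θ x + e0 + ei - e0 = θ x + ei := by abel
  have m3 : θ x + e0 - ei = θ x - ei + e0 := by abel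
  have m4 : θ x - ei - e0 = θ x - e0 - ei := by abel
  simp only [cloverLeafSum, ← he0, ← hei, hV0, hV _ _ hi, hθ0, hθ0', hθi, hi', sub_add_cancel,
    m1, m2, m3, m4, ← conjTranspose_map_of_mem_unitaryGroup ρ hρ, conjTranspose_add,
    conjTranspose_mul, conjTranspose_conjTranspose, Matrix.mul_assoc]
  abel

/-- Spatial clover field tensors are carried along: `C_{μν}(V, x) = C_{μν}(U, θx)`, `μ, ν ≠ 0`. [folklore] -/
theorem flowedClover_zero_reflect_of_ne (θ : (Fin d → R) → (Fin d → R))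
    (hθ : ∀ x (i : Fin d), i ≠ 0 → θ (x + Pi.single i 1) = θ x + Pi.single i 1)
    (U V : (Fin d → R) × Fin d → G) (hV : ∀ x (i : Fin d), i ≠ 0 → V (x, i) = U (θ x, i))
    (x : Fin d → R) {μ ν : Fin d} (hμ : μ ≠ 0) (hν : ν ≠ 0) :
    flowedClover ρ 0 V x μ ν = flowedClover ρ 0 U (θ x) μ ν := by
  rw [flowedClover_zero, flowedClover_zero, cloverLeafSum_reflect_of_ne ρ θ hθ U V hV x hμ hν]

/-- **Temporal clover field tensors change sign**: `C_{0i}(V, x) = −C_{0i}(U, θx)` — the reversed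
loops give `Qᴴ`, and `π_𝔤(Wᴴ) = −π_𝔤(W)` since `𝔤 ⊆ 𝔲(N)`. [folklore] -/
theorem flowedClover_zero_reflect_zero (hρ : ∀ g, ρ g ∈ Matrix.unitaryGroup (Fin N) ℂ)
    (θ : (Fin d → R) → (Fin d → R)) (hθ0 : ∀ x, θ (x + Pi.single 0 1) = θ x - Pi.single 0 1)
    (hθ : ∀ x (i : Fin d), i ≠ 0 → θ (x + Pi.single i 1) = θ x + Pi.single i 1)
    (U V : (Fin d → R) × Fin d → G) (hV0 : ∀ x, V (x, 0) = (U (θ (x + Pi.single 0 1), 0))⁻¹)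
    (hV : ∀ x (i : Fin d), i ≠ 0 → V (x, i) = U (θ x, i)) (x : Fin d → R) {i : Fin d} (hi : i ≠ 0) :
    flowedClover ρ 0 V x 0 i = -flowedClover ρ 0 U (θ x) 0 i := by
  rw [flowedClover_zero, flowedClover_zero, cloverLeafSum_reflect_zero ρ hρ θ hθ0 hθ U V hV0 hV x hi,
    ← lieProjection_conjTranspose (range_subset_unitaryGroup ρ hρ), conjTranspose_smul, star_trivial]

/-- **The clover action density is even under time reflections**: `S_x(ΘU) = S_{θx}(U)`. [folklore] -/
theorem flowedCloverEnergy_zero_reflect (hρ : ∀ g, ρ g ∈ Matrix.unitaryGroup (Fin N) ℂ)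
    (θ : (Fin d → R) → (Fin d → R)) (hθ0 : ∀ x, θ (x + Pi.single 0 1) = θ x - Pi.single 0 1)
    (hθ : ∀ x (i : Fin d), i ≠ 0 → θ (x + Pi.single i 1) = θ x + Pi.single i 1)
    (U V : (Fin d → R) × Fin d → G) (hV0 : ∀ x, V (x, 0) = (U (θ (x + Pi.single 0 1), 0))⁻¹)
    (hV : ∀ x (i : Fin d), i ≠ 0 → V (x, i) = U (θ x, i)) (x : Fin d → R) :
    flowedCloverEnergy ρ 0 x V = flowedCloverEnergy ρ 0 (θ x) U := by
  unfold flowedCloverEnergy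
  refine Finset.sum_congr rfl fun μ _ => Finset.sum_congr rfl fun ν _ => ?_
  split_ifs with hμν
  · have hν : ν ≠ 0 := by
      rintro rfl
      have h := Fin.lt_def.1 hμν
      simp at h
    rcases eq_or_ne μ 0 with rfl | hμ
    · rw [flowedClover_zero_reflect_zero ρ hρ θ hθ0 hθ U V hV0 hV x hν, conjTranspose_neg,
        neg_mul_neg]
    · rw [flowedClover_zero_reflect_of_ne ρ θ hθ U V hV x hμ hν]
  · rfl

/-- **The clover pseudoscalar density is odd under time reflections**: `P_x(ΘU) = −P_{θx}(U)`
(each of the three terms of `P` contains exactly one temporal clover). The lattice form of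
"`q` is a pseudoscalar" behind `−⟨q(0)q(x)⟩ ≥ 0`. [cite: AguadoSeiler2005, §1] -/
theorem cloverPseudoscalar_reflect (hρ : ∀ g, ρ g ∈ Matrix.unitaryGroup (Fin N) ℂ)
    (θ : (Fin 4 → R) → (Fin 4 → R)) (hθ0 : ∀ x, θ (x + Pi.single 0 1) = θ x - Pi.single 0 1)
    (hθ : ∀ x (i : Fin 4), i ≠ 0 → θ (x + Pi.single i 1) = θ x + Pi.single i 1)
    (U V : (Fin 4 → R) × Fin 4 → G) (hV0 : ∀ x, V (x, 0) = (U (θ (x + Pi.single 0 1), 0))⁻¹)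
    (hV : ∀ x (i : Fin 4), i ≠ 0 → V (x, i) = U (θ x, i)) (x : Fin 4 → R) :
    cloverPseudoscalar ρ x V = -cloverPseudoscalar ρ (θ x) U := by
  have ht : ∀ i : Fin 4, i ≠ 0 → flowedClover ρ 0 V x 0 i = -flowedClover ρ 0 U (θ x) 0 i :=
    fun i hi => flowedClover_zero_reflect_zero ρ hρ θ hθ0 hθ U V hV0 hV x hi
  have hs : ∀ μ ν : Fin 4, μ ≠ 0 → ν ≠ 0 → flowedClover ρ 0 V x μ ν = flowedClover ρ 0 U (θ x) μ ν :=
    fun μ ν hμ hν => flowedClover_zero_reflect_of_ne ρ θ hθ U V hV x hμ hν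
  rw [cloverPseudoscalar, cloverPseudoscalar, ht 1 (by decide), ht 2 (by decide), ht 3 (by decide),
    hs 2 3 (by decide) (by decide), hs 1 3 (by decide) (by decide), hs 1 2 (by decide) (by decide)]
  simp only [Matrix.neg_mul, Matrix.trace_sub, Matrix.trace_add, Matrix.trace_neg, Complex.sub_re,
    Complex.add_re, Complex.neg_re]
  ring

end Reflection

/-! ### The pointwise bound `|P| ≤ S` -/

section Bound

variable {N : ℕ}

/-- **Cauchy–Schwarz for the real Hilbert–Schmidt form**: `|Re tr(A B)| ≤ (‖A‖² + ‖B‖²)/2`,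
written with `‖A‖² = Re tr(A† A)`. [folklore] -/
theorem abs_re_trace_mul_le (A B : Matrix (Fin N) (Fin N) ℂ) :
    |(Matrix.trace (A * B)).re| ≤
      ((Matrix.trace (Aᴴ * A)).re + (Matrix.trace (Bᴴ * B)).re) / 2 := by
  have h1 : (Matrix.trace (A * B)).re = inner ℝ Aᴴ B := by
    rw [frobenius_inner_def, conjTranspose_conjTranspose]
  have hA : (Matrix.trace (Aᴴ * A)).re = ‖A‖ ^ 2 := by
    rw [Matrix.frobenius_norm_sq_eq_re_trace, RCLike.re_to_complex]
  have hB : (Matrix.trace (Bᴴ * B)).re = ‖B‖ ^ 2 := by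
    rw [Matrix.frobenius_norm_sq_eq_re_trace, RCLike.re_to_complex]
  rw [h1, hA, hB]
  calc |inner ℝ Aᴴ B| ≤ ‖Aᴴ‖ * ‖B‖ := abs_real_inner_le_norm _ _
    _ = ‖A‖ * ‖B‖ := by rw [Matrix.frobenius_norm_conjTranspose]
    _ ≤ (‖A‖ ^ 2 + ‖B‖ ^ 2) / 2 := by nlinarith [two_mul_le_add_sq ‖A‖ ‖B‖]

variable {R : Type*} [AddGroup R] [One R] {G : Type*} [Group G] (ρ : G →* Matrix (Fin N) (Fin N) ℂ)

/-- The clover action density written out over the six planes of `Fin 4`. [folklore] -/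
theorem flowedCloverEnergy_four (t : ℝ) (x : Fin 4 → R) (U : (Fin 4 → R) × Fin 4 → G) :
    flowedCloverEnergy ρ t x U =
      ((flowedClover ρ t U x 0 1)ᴴ * flowedClover ρ t U x 0 1).trace.re +
      ((flowedClover ρ t U x 0 2)ᴴ * flowedClover ρ t U x 0 2).trace.re +
      ((flowedClover ρ t U x 0 3)ᴴ * flowedClover ρ t U x 0 3).trace.re +
      ((flowedClover ρ t U x 1 2)ᴴ * flowedClover ρ t U x 1 2).trace.re +
      ((flowedClover ρ t U x 1 3)ᴴ * flowedClover ρ t U x 1 3).trace.re +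
      ((flowedClover ρ t U x 2 3)ᴴ * flowedClover ρ t U x 2 3).trace.re := by
  simp only [flowedCloverEnergy, Fin.sum_univ_four, Fin.isValue, Fin.reduceLT, ↓reduceIte,
    add_zero, zero_add, lt_self_iff_false]
  ring

/-- **`|P_x(U)| ≤ S_x(U)` pointwise** (any group, representation, configuration, site): the
untruncated Muzinich–Nair inequality `tr F² ≥ |tr F F̃|`, i.e. `S ± P ≥ 0`; three applications of
`|Re tr(C C')| ≤ (‖C‖² + ‖C'‖²)/2`, each plane being used exactly once. [cite: MuzinichNair1986, eqs. (5)–(10)] -/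
theorem abs_cloverPseudoscalar_le_flowedCloverEnergy (x : Fin 4 → R) (U : (Fin 4 → R) × Fin 4 → G) :
    |cloverPseudoscalar ρ x U| ≤ flowedCloverEnergy ρ 0 x U := by
  have b1 := abs_re_trace_mul_le (flowedClover ρ 0 U x 0 1) (flowedClover ρ 0 U x 2 3)
  have b2 := abs_re_trace_mul_le (flowedClover ρ 0 U x 0 2) (flowedClover ρ 0 U x 1 3)
  have b3 := abs_re_trace_mul_le (flowedClover ρ 0 U x 0 3) (flowedClover ρ 0 U x 1 2)
  have ht := abs_add_le
    ((flowedClover ρ 0 U x 0 1 * flowedClover ρ 0 U x 2 3).trace.re -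
      (flowedClover ρ 0 U x 0 2 * flowedClover ρ 0 U x 1 3).trace.re)
    ((flowedClover ρ 0 U x 0 3 * flowedClover ρ 0 U x 1 2).trace.re)
  have hs := abs_sub ((flowedClover ρ 0 U x 0 1 * flowedClover ρ 0 U x 2 3).trace.re)
    ((flowedClover ρ 0 U x 0 2 * flowedClover ρ 0 U x 1 3).trace.re)
  rw [flowedCloverEnergy_four, cloverPseudoscalar]
  simp only [Matrix.trace_sub, Matrix.trace_add, Complex.sub_re, Complex.add_re, abs_mul, abs_neg,
    abs_two]
  linarith

/-- `S + P ≥ 0`: the self-dual part `O⁺ = S + P` is non-negative. [cite: MuzinichNair1986, eqs. (7)–(10)] -/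
theorem cloverEnergy_add_pseudoscalar_nonneg (x : Fin 4 → R) (U : (Fin 4 → R) × Fin 4 → G) :
    0 ≤ flowedCloverEnergy ρ 0 x U + cloverPseudoscalar ρ x U := by
  have h := abs_cloverPseudoscalar_le_flowedCloverEnergy ρ x U
  rw [abs_le] at h
  linarith

/-- `S − P ≥ 0`: the anti-self-dual part `O⁻ = S − P` is non-negative. [cite: MuzinichNair1986, eqs. (7)–(10)] -/
theorem cloverEnergy_sub_pseudoscalar_nonneg (x : Fin 4 → R) (U : (Fin 4 → R) × Fin 4 → G) :
    0 ≤ flowedCloverEnergy ρ 0 x U - cloverPseudoscalar ρ x U := by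
  have h := abs_cloverPseudoscalar_le_flowedCloverEnergy ρ x U
  rw [abs_le] at h
  linarith

end Bound

end Literature.MathematicalPhysics.QuantumLattice

end
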